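import Literature.IUT.HodgeArakelov.AbsTopMonoidsGenuineZHatPow
import Literature.IUT.HodgeArakelov.GaloisPairRigidityForgetSurjective
import Literature.IUT.HodgeArakelov.AbsTopMonoidsGenuineIsometries
import HarnessLib

/-!
# [IUTchII] Rmk 1.11.1 (i) (b) UNCONDITIONAL at the genuine producers: `Aut(G ↷ O^×(G)) ↠ Aut(G)` with kernel THE
# `Ẑ^×`-powers (FACT-LIST F-0418 at `genuineOfModel` / `genuineOfModelIsm`; proof-only sequel of `AbsTopMonoidsGenuineZHatPow`)

S. Mochizuki, *Inter-universal Teichmüller theory II*, §1, Remark 1.11.1 (i) (b), kurims manuscript (Dec. 2020) p. 50: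
«in the case of (∗×), the group of automorphisms of the MLF-Galois TM-pair `G ↷ O^×(G)` maps surjectively … onto the
group of automorphisms of the topological group `G`, with kernel given by the [`G`-linear] automorphisms of the
underlying ind-topological module of `O^×(G)` determined by the natural action of `Ẑ^×` [cf. [AbsTopIII], Proposition
3.3, (ii)]» [claim: Mochizuki2012, status: disputed] (IUTchII §1 Rmk 1.11.1 (i), kurims p.50); [AbsTopIII] Prop. 3.3 (ii)
p. 74 [MochizukiAbsTopIII2015]. abc-iut cell, layer L6, seat abc-iut-w6-d010, row «RMK1111B-GENUINE» (L6-lead 07:33:01Z),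
file B. PROOF-ONLY (no `def` / `structure` / `instance`).

abc-iut-L6-t1's named fact `Rmk1111_b A zhatPow` (`GaloisPairRigidity.lean`, FACT-LIST F-0418) = surjectivity of
`Aut(G ↷ O^×(G)) → Aut(G)` ∧ (every pair automorphism over `1 ∈ Aut(G)` is `zhatPow G u` for some `u ∈ Ẑ^×`) ∧ (every
`zhatPow G u` is a pair automorphism over `1`). abc-iut-w6-d016 proved the first conjunct for every `A`
(`Rmk1111_b_surjective`) and isolated the residual as the two kernel clauses «at a genuine `Ẑ^×`-exponentiation on
`O^×`» (`Rmk1111_b_iff_kernel`). File A (`AbsTopMonoidsGenuineZHatPow`) CONSTRUCTED that exponentiation at the genuine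
producers (`Genuine.zhatPowOunits C : Ẑ^× →* Aut((𝒪_k̄^⊳)ˣ)`, the natural `x ↦ x^u`) and proved the third conjunct
(`one_zhatPowOunits_mem_pairAut`). HERE:

* `Genuine.exists_levelExp_modEq_of_compatible` — `Ẑ^× ↠` {compatible unit exponent systems}: every compatible unit
  system `a` is `χ(u)` for some `u ∈ Aut(Ẑ)` (abc-iut L2's `ZHatLevel.autOfLevelFamily` / `levelChar_autOfLevelFamily`);
* `Genuine.exists_zhatUnitAut_eq_of_equivariant` — **the converse of [AbsTopIII] Prop. 3.3 (ii) at the model**: EVERY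
  `Gal(k̄/k)`-equivariant automorphism of `𝒪_k̄^×` IS `x ↦ x^u` (abc-iut-L6-d1's `equivariant_unitMulEquiv_exponents` +
  the above + uniqueness `zhatUnitAut_unique`);
* `Genuine.exists_eq_zhatPowOunits_of_forget_eq_one` — the KERNEL CLAUSE at the genuine producer: a pair automorphism of
  `G ↷ O^×(G)` over `1 ∈ Aut(G)` (a `G`-linear automorphism of `(𝒪_k̄^⊳)ˣ`; `G ⥲ Gal(k̄/k)` through `theta` is onto, so
  `G`-linear = `Gal(k̄/k)`-equivariant) IS `zhatPowOunits C u`;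
* **`rmk1111_b_genuineOfModel`, `rmk1111_b_genuineOfModelIsm` : `Rmk1111_b (…) (fun _ => Genuine.zhatPowOunits C)`** —
  [IUTchII] Rmk 1.11.1 (i) (b) HOLDS at both genuine producers with the `Ẑ^×`-action datum SUPPLIED (not assumed).
With abc-iut-L6-d2's `rmk1111_d_genuineOfModelIsm` ((d)) and this seat's `rmk1111_a_genuineOfModelIsm` ((a),
`GaloisPairRigidityGenuine`), clauses (a), (b), (d) of Remark 1.11.1 (i) are now theorems at the fully genuine producer;
(c) (`O^ĝp`) is abc-iut-w6-d016's `(∗gp)` lane. HONEST FRAMING: OUR kernel consequences of classical statements ([AbsTopIII],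
Kummer theory over MLFs — all inputs proved in the tree); nothing here bears on [IUTchIII] Cor. 3.12 or takes a side.
-/

namespace Literature.IUT.HodgeArakelov

open CategoryTheory
open Literature.AnabelianGeometry.AbsoluteAnabelian
open Literature.AnabelianGeometry.EtaleTheta

namespace AbsTopMonoids

namespace Genuine

variable (C : MLFClosure.{0})

/-! ## Every compatible unit exponent system is `χ(u)` for some `u ∈ Ẑ^×` -/

/-- **Surjectivity of the exponent systems** (`Ẑ^× = lim (ℤ/nℤ)^×`, abc-iut L2's `ZHatLevel.autOfLevelFamily`): every
compatible unit exponent system `a` is `levelExp u` modulo each `n`, for some `u ∈ Ẑ^× = Aut(Ẑ)`.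
[cite: MochizukiAbsTopIII2015, Proposition 3.3 (ii) p.74] -/
theorem exists_levelExp_modEq_of_compatible (a : ℕ → ℕ)
    (ha : ∀ m n : ℕ, 0 < m → 0 < n → m ∣ n → a n ≡ a m [MOD m]) (hcop : ∀ n, 0 < n → (a n).Coprime n) :
    ∃ u : ZHatUnits, ∀ n, 0 < n → levelExp u n ≡ a n [MOD n] := by
  -- the two inverse compatible unit families `(a n)_n`, `(a n)⁻¹_n` in `∏ (ℤ/nℤ)`
  let U : ∀ n : ℕ+, (ZMod n)ˣ := fun n => ZMod.unitOfCoprime (a n) (hcop n n.pos)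
  have hU : ∀ n : ℕ+, ((U n : (ZMod n)ˣ) : ZMod n) = (a n : ZMod n) := fun n => ZMod.coe_unitOfCoprime _ _
  have hcompat : ∀ (n N : ℕ+) (h : (n : ℕ) ∣ N), ZMod.castHom h (ZMod n) ((a N : ℕ) : ZMod N) = (a n : ZMod n) := by
    intro n N h
    rw [map_natCast]
    exact (ZMod.natCast_eq_natCast_iff _ _ _).2 (ha n N n.pos N.pos h)
  have hmapU : ∀ (n N : ℕ+) (h : (n : ℕ) ∣ N),
      Units.map (ZMod.castHom h (ZMod n) : ZMod N →+* ZMod n).toMonoidHom (U N) = U n := by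
    intro n N h
    ext
    rw [Units.coe_map, hU, hU]
    exact hcompat n N h
  let f : ZHatLevel.LevelFamily := ⟨fun n => (a n : ZMod n), fun n N h => hcompat n N h⟩
  let g : ZHatLevel.LevelFamily := ⟨fun n => (((U n)⁻¹ : (ZMod n)ˣ) : ZMod n), fun n N h => by
    rw [← hmapU n N h, Units.coe_map_inv]
    rfl⟩
  have hfg : ∀ n : ℕ+, f.c n * g.c n = 1 := fun n => by
    change (a n : ZMod n) * (((U n)⁻¹ : (ZMod n)ˣ) : ZMod n) = 1
    rw [← hU, Units.mul_inv]
  refine ⟨ZHatLevel.autOfLevelFamily f g hfg, fun n hn => ?_⟩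
  rw [levelExp_of_pos _ hn, ZHatLevel.levelChar_autOfLevelFamily]
  change ((a n : ZMod (⟨n, hn⟩ : ℕ+))).val ≡ a n [MOD n]
  rw [ZMod.val_natCast]
  exact Nat.mod_modEq _ _

/-- **The converse** ([AbsTopIII] Prop. 3.3 (ii) for `TCG` at the model; [IUTchII] Rmk 1.11.1 (i) (b) «kernel given by …
the natural action of `Ẑ^×`»): EVERY `Gal(k̄/k)`-equivariant multiplicative automorphism of `𝒪_k̄^×` IS `x ↦ x^u` for
some `u ∈ Ẑ^×` (abc-iut-L6-d1's `equivariant_unitMulEquiv_exponents` + `exists_levelExp_modEq_of_compatible` +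
uniqueness). [claim: Mochizuki2012, status: disputed] (IUTchII §1 Rmk 1.11.1 (i), kurims p.50) -/
theorem exists_zhatUnitAut_eq_of_equivariant (β : unitSubmonoid C.k C.K ≃* unitSubmonoid C.k C.K)
    (hβ : UnitsGalEquivariant C β) : ∃ u : ZHatUnits, zhatUnitAut C u = β := by
  obtain ⟨a, ha, hcop, hμ⟩ := C.equivariant_unitMulEquiv_exponents β
  obtain ⟨u, hu⟩ := exists_levelExp_modEq_of_compatible a ha hcop
  refine ⟨u, (zhatUnitAut_unique C u β hβ fun x m hm hx => ?_).symm⟩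
  rw [hμ x m hm hx, pow_eq_pow_mod (a m) hx, pow_eq_pow_mod (levelExp u m) hx,
    show a m % m = levelExp u m % m from (hu m hm).symm]

variable (S : ThetaSetting.{0}) (ε : S.Gk ≃ₜ* (ModelMLFGaloisData.galois C.k C.K).tmPair.Pi)
  (hΔ : ∀ f : S.PiX ≃ₜ* S.PiX, S.DeltaX.map f.toMulEquiv.toMonoidHom = S.DeltaX)
  (hq : Nonempty (TopGroup.quot S.PiX S.DeltaX ≃ₜ* S.Gk))

/-- **Kernel clause at the genuine producer** ([IUTchII] Rmk 1.11.1 (i) (b)): an automorphism of the pair `G ↷ O^×(G)`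
over `1 ∈ Aut(G)` — i.e. a `G`-linear automorphism `ψ` of `O^×(G) = (𝒪_k̄^⊳)ˣ` — IS `zhatPowOunits C u` for some
`u ∈ Ẑ^×`: transported along `(𝒪_k̄^⊳)ˣ ≅ 𝒪_k̄^×`, `ψ` is `Gal(k̄/k)`-equivariant (`G ⥲ Gal(k̄/k)` via `theta` is
onto), hence a `Ẑ^×`-power by `exists_zhatUnitAut_eq_of_equivariant`. [claim: Mochizuki2012, status: disputed]
(IUTchII §1 Rmk 1.11.1 (i), kurims p.50) -/
theorem exists_eq_zhatPowOunits_of_forget_eq_one (G : IsoClass S.Gk)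
    (p : PairAut G ((genuineOfModel S C ε hΔ hq).Ounits G) ((genuineOfModel S C ε hΔ hq).actOunits G))
    (hp : PairAut.forget p = 1) : ∃ u : ZHatUnits, p.1.2 = zhatPowOunits C u := by
  set e := ModelMLFGaloisData.unitsEquivUnitSubmonoid C with he
  -- `ψ := p.1.2` read on `𝒪_k̄^× = unitSubmonoid`
  set β : unitSubmonoid C.k C.K ≃* unitSubmonoid C.k C.K := e.symm.trans (p.1.2.trans e) with hβdef
  have hβ : UnitsGalEquivariant C β := by
    intro σ x y hxy
    obtain ⟨g, hg⟩ := (theta C ε G).surjective σ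
    -- the `G`-action on `O^×(G) = (𝒪_k̄^⊳)ˣ` read on `k̄`: `g` acts through the field automorphism `theta g = σ`
    have hact : ∀ z : (nonzeroIntegers C.k C.K)ˣ,
        ((@Units.val (nonzeroIntegers C.k C.K) _ ((genuineOfModel S C ε hΔ hq).actOunits G g z) :
          nonzeroIntegers C.k C.K) : C.K) = σ ((z : nonzeroIntegers C.k C.K) : C.K) :=
      fun z => by rw [← hg]; rfl
    -- `y = g • x` on `(𝒪_k̄^⊳)ˣ`
    have hyx : e.symm y = (genuineOfModel S C ε hΔ hq).actOunits G g (e.symm x) := by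
      apply e.injective
      apply Subtype.ext
      rw [MulEquiv.apply_symm_apply, ModelMLFGaloisData.coe_unitsEquivUnitSubmonoid, hact,
        ← ModelMLFGaloisData.coe_unitsEquivUnitSubmonoid C (e.symm x), MulEquiv.apply_symm_apply]
      exact hxy
    have hcomm := PairAut.smul_comm_of_forget_eq_one p hp g (e.symm x)
    change ((e (p.1.2 (e.symm y)) : unitSubmonoid C.k C.K) : C.K) =
      σ ((e (p.1.2 (e.symm x)) : unitSubmonoid C.k C.K) : C.K)
    rw [ModelMLFGaloisData.coe_unitsEquivUnitSubmonoid, ModelMLFGaloisData.coe_unitsEquivUnitSubmonoid, hyx, hcomm,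
      hact]
  obtain ⟨u, hu⟩ := exists_zhatUnitAut_eq_of_equivariant C β hβ
  refine ⟨u, MulEquiv.ext fun x => ?_⟩
  have hx : zhatUnitAut C u (e x) = e (p.1.2 (e.symm (e x))) := MulEquiv.congr_fun hu (e x)
  change p.1.2 x = e.symm (zhatUnitAut C u (e x))
  rw [hx, MulEquiv.symm_apply_apply, MulEquiv.symm_apply_apply]

/-- **IUTchII:Rmk1.11.1(i) (b) UNCONDITIONAL at the genuine-mod-`ε` producer** (FACT-LIST F-0418 at `genuineOfModel`,
with the `Ẑ^×`-action DATUM supplied: `zhatPow := zhatPowOunits C`, the natural `Ẑ^×`-powers on `O^×(G) = (𝒪_k̄^⊳)ˣ`):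
the forgetful map `Aut(G ↷ O^×(G)) → Aut(G)` is surjective (abc-iut-w6-d016's `Rmk1111_b_surjective`, every `A`),
its kernel consists of the `Ẑ^×`-powers (`exists_eq_zhatPowOunits_of_forget_eq_one`), and every `Ẑ^×`-power is
`G`-linear (`one_zhatPowOunits_mem_pairAut`) — «with kernel given by the [`G`-linear] automorphisms … determined by
the natural action of `Ẑ^×` [cf. [AbsTopIII], Proposition 3.3, (ii)]». [claim: Mochizuki2012, status: disputed]
(IUTchII §1 Rmk 1.11.1 (i), kurims p.50) -/
theorem rmk1111_b_genuineOfModel : Rmk1111_b (genuineOfModel S C ε hΔ hq) (fun _ => zhatPowOunits C) :=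
  fun G => ⟨Rmk1111_b_surjective (genuineOfModel S C ε hΔ hq) G,
    fun p hp => exists_eq_zhatPowOunits_of_forget_eq_one C S ε hΔ hq G p hp,
    fun u => one_zhatPowOunits_mem_pairAut C S ε hΔ hq G u⟩

/-- **IUTchII:Rmk1.11.1(i) (b) UNCONDITIONAL at the fully genuine producer** `genuineOfModelIsm` (abc-iut-L6-d2; its
`O^×(G)` and `G`-action are those of `genuineOfModel`), with `zhatPow := zhatPowOunits C` — next to abc-iut-L6-d2's
`rmk1111_d_genuineOfModelIsm` ((d): on `O^{×μ}` the analogous kernel description FAILS) and this seat's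
`rmk1111_a_genuineOfModelIsm` ((a)). [claim: Mochizuki2012, status: disputed] (IUTchII §1 Rmk 1.11.1 (i), kurims p.50) -/
theorem rmk1111_b_genuineOfModelIsm : Rmk1111_b (genuineOfModelIsm S C ε hΔ hq) (fun _ => zhatPowOunits C) :=
  rmk1111_b_genuineOfModel C S ε hΔ hq

end Genuine

end AbsTopMonoids

end Literature.IUT.HodgeArakelov
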